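import Mathlib.LinearAlgebra.Trace
import Literature.RepresentationTheory.HeisenbergGroup.SchrodingerBigCellSection
import HarnessLib

/-!
# Finite-level trace of a family of big-cell operators on the fixed vectors of a smooth representation

Topic `RepresentationTheory/HeisenbergGroup`; namespace `Literature.RepresentationTheory.HeisenbergGroup`.
THEOREMS ONLY (no definition, no named fact, no `sorry`).

For `F` non-archimedean local (`2` invertible), `ψ` non-trivial continuous of conductor exponent `m`, `μ` a Haar
measure on `F` and the standard operators `r(n(c)) = unipOpPi`, `r(m(a)) = leviOpPi`, `r(w) = fourierOpPi` of the
smooth Schrödinger model on `𝒮(F^ι)` (`SchrodingerPiOperators.lean`), a CANONICAL WORD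
`r(γ, B, δ) := r(n(γ)) r(m(B)) r(w) r(n(δ))` (Weil's big-cell operator `r(g)` of `g = n(γ) m(B) w n(δ)`,
[Weil1964] n° 13 (29); `bigCellOp`, `SchrodingerBigCellSection.lean`) is the integral operator with kernel
`k(x, y) = ψ(-½⟨x, γx⟩) |det B|^{-1/2} ψ(⟨y, B⁻¹x⟩) ψ(-½⟨y, δy⟩)` (`coe_canonicalWordOp_apply`), whose DIAGONAL is
the second-degree character `|det B|^{-1/2} ψ(⟨x, B⁻¹x⟩ - ½⟨x, γx⟩ - ½⟨x, δx⟩)`.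

MAIN THEOREM `trace_restrict_fixed_eq_of_bigCell_family` (the generic half «H2» of the finite-level character
non-vanishing «TR» of the `(U(1), U(1))` oscillator representation; cell `hodgecm-mathlib`, route of record for the
`c3` wall `NonPeriodic₁₁`): let `ω` be ANY representation of a group `G` on `𝒮(F^ι)`, `K ≤ G`, `z₀ ∈ G`, such that
on the coset `z₀K` the operators are big-cell words with a COMMON kernel prefactor `c` (hypothesis `hW1`:
`ω(z₀k) = (c |det B_k|^{1/2}) · r(γ_k, B_k, δ_k)`), a COMMON value `Gv` of the Gauss integrals of the diagonal forms
over all deep box lattices `(𝔭ⁿ)^ι`, `n ≤ m₀` (`hW2`), a uniform bound `q^{e₀}` on `γ_k, B_k⁻¹, δ_k` (`hW3`), and such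
that every Schwartz–Bruhat function is fixed by a finite-index subgroup of `K` (`hW4`, smoothness); then for the
finite-dimensional space `W` of `ω(K)`-fixed vectors

  `tr(ω(z₀) | W) = c · Gv`.

Proof ([Howe1973]'s character formula of the Weil representation, READ AT FINITE LEVEL and proved from the kernel):
`W` lies in the finite-dimensional space `U` of functions supported on a box `B = (𝔭^L)^ι` and periodic under a
lattice `Λ = (𝔭^{L'})^ι`, with `L ≤ m₀` and `Λ` so deep that every word kernel is `Λ × Λ`-invariant on `B × B`
(`hW3`); for a finite-index `K₁ ≤ K` fixing `U` pointwise (`hW4`) the average `P = [K:K₁]⁻¹ Σ_{K/K₁} ω(k)` is the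
identity on `W` and maps `U` into `W`, so `tr(ω(z₀)|W) = tr(ω(z₀)P|U)` (`trace_restrict_eq_trace_comp_average_restrict`);
`ω(z₀)P` is a kernel operator on `U` whose kernel is the average of the word kernels (`hW1`, Fubini for finite
sums), and the trace of a kernel operator on `U` with a `Λ × Λ`-invariant kernel is the integral of the diagonal over
`B` (`trace_restrict_boxSpace_eq_setIntegral_diag`, matrix in the basis of coset indicators), i.e. `c ·` the average of the
Gauss integrals `= c · Gv` (`hW2`).

## References
* [Weil1964] A. Weil, Acta Math. 111 (1964), n° 13 (29) p. 160; Chap. II n° 27 p. 175.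
* [Howe1973] R. Howe, *On the character of Weil's representation*, Trans. AMS 177 (1973), 287–298 (the character is
  `|det(1-g)|^{-1/2}` up to a phase on the regular set).
* [Rangarao1993] R. Ranga Rao, Pacific J. Math. 157 (1993), Lemma 3.2, (3.12).
* [MoeglinVignerasWaldspurger1987] C. Mœglin, M.-F. Vignéras, J.-L. Waldspurger, LNM 1291 (1987), Chap. 2 II.1–II.8.
-/

set_option autoImplicit false

noncomputable section

namespace Literature.RepresentationTheory.HeisenbergGroup

open _root_.MeasureTheory Matrix
open scoped Pointwise
open Literature.NumberTheory.Automorphic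
open Literature.NumberTheory.GaloisRepresentations.IsNonarchimedeanLocalField
open Literature.NumberTheory.Weil1964

/-! ## §0 Linear algebra: moving a trace along an averaging projector -/

section LinearAlgebra

variable {S : Type*} [AddCommGroup S] [Module ℂ S]

/-- **trace transfer along a projector**: for `W ≤ U` finite-dimensional, `T` preserving `W`, `P = id` on `W` and
`T ∘ P` mapping `U` into `W`, `tr(T|W) = tr(T ∘ P|U)` (both are the trace of `U → W → U`).
[cite: MoeglinVignerasWaldspurger1987, Chap. 2 II.2] -/
theorem trace_restrict_eq_trace_comp_average_restrict (W U : Submodule ℂ S) [FiniteDimensional ℂ U] (hWU : W ≤ U)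
    (T P : S →ₗ[ℂ] S) (hT : ∀ w ∈ W, T w ∈ W) (hP : ∀ w ∈ W, P w = w) (hTP : ∀ u ∈ U, T (P u) ∈ W) :
    LinearMap.trace ℂ W (T.restrict hT) =
      LinearMap.trace ℂ U ((T ∘ₗ P).restrict (fun u hu => hWU (hTP u hu))) := by
  haveI : FiniteDimensional ℂ W := Submodule.finiteDimensional_of_le hWU
  let g : U →ₗ[ℂ] W := ((T ∘ₗ P).domRestrict U).codRestrict W (fun u => hTP u u.2)
  let i : W →ₗ[ℂ] U := Submodule.inclusion hWU
  have h1 : (T ∘ₗ P).restrict (fun u hu => hWU (hTP u hu)) = i ∘ₗ g := by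
    apply LinearMap.ext; intro u; rfl
  have h2 : T.restrict hT = g ∘ₗ i := by
    apply LinearMap.ext; intro w
    apply Subtype.ext
    show T w = T (P w)
    rw [hP w w.2]
  rw [h1, h2]
  exact LinearMap.trace_comp_comm' i g

end LinearAlgebra

/-! ## §1 The kernel of a canonical word and its local constancy -/

section Kernel

variable {F : Type*} [Field F] [ValuativeRel F] [TopologicalSpace F] [IsNonarchimedeanLocalField F]
  {ι : Type*} [Fintype ι] [DecidableEq ι] [Invertible (2 : F)]
  {ψ : AddChar F Circle} (hl : IsLocallyConstant (⇑ψ : F → Circle))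
  [MeasurableSpace F] [BorelSpace F] (μ : Measure F) [μ.IsAddHaarMeasure] {m : ℤ}

omit [DecidableEq ι] in
/-- **the canonical word is an integral operator**:
`(r(n(γ)) r(m(B)) r(w) r(n(δ)) Φ)(x) = ∫ [ψ(-½⟨x,γx⟩) |det B|^{-1/2} ψ(⟨y, B⁻¹x⟩) ψ(-½⟨y,δy⟩)] Φ(y) dy`.
[cite: Weil1964, n° 13 (29), p. 160; Rangarao1993, Lemma 3.2, (3.12)] -/
theorem coe_canonicalWordOp_apply (hψ : ψ.IsContinuousNontrivial) (hm : ψ.HasConductorExp m)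
    (γ δ : (ι → F) →ₗ[F] (ι → F)) (B : (ι → F) ≃ₗ[F] (ι → F)) (f : SchwartzBruhat (ι → F)) (x : ι → F) :
    (((unipOpPi hl γ * leviOpPi B * fourierOpPi μ hψ hm * unipOpPi hl δ :
        SchwartzBruhat (ι → F) ≃ₗ[ℂ] SchwartzBruhat (ι → F)) f : SchwartzBruhat (ι → F)) : (ι → F) → ℂ) x =
      ∫ y, (((ψ (-halfForm γ x) : Circle) : ℂ) * (((modSqrt B : ℂ))⁻¹ *
          ((((ψ (y ⬝ᵥ B.symm x)) : Circle) : ℂ) * (((ψ (-halfForm δ y)) : Circle) : ℂ)))) *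
            (f : (ι → F) → ℂ) y ∂(Measure.pi fun _ : ι => μ) := by
  rw [LinearEquiv.mul_apply, LinearEquiv.mul_apply, LinearEquiv.mul_apply, coe_unipOpPi_apply, coe_leviOpPi_apply,
    coe_fourierOpPi, piFourierSB_apply, ← integral_const_mul, ← integral_const_mul]
  refine integral_congr_ae (Filter.Eventually.of_forall fun y => ?_)
  simp only [coe_unipOpPi_apply]
  ring

omit [ValuativeRel F] [TopologicalSpace F] [IsNonarchimedeanLocalField F] [DecidableEq ι] [Invertible (2 : F)]
  [MeasurableSpace F] [BorelSpace F] in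
/-- bilinear bookkeeping: `⟨x + h, c(x + h)⟩ - ⟨x, cx⟩ = ⟨x, ch⟩ + ⟨h, cx⟩ + ⟨h, ch⟩`. [cite: Weil1964, n° 13, p. 160] -/
theorem dotProduct_map_add_sub (c : (ι → F) →ₗ[F] (ι → F)) (x h : ι → F) :
    (x + h) ⬝ᵥ c (x + h) - x ⬝ᵥ c x = x ⬝ᵥ c h + h ⬝ᵥ c x + h ⬝ᵥ c h := by
  rw [map_add, add_dotProduct, dotProduct_add, dotProduct_add]
  ring

omit [DecidableEq ι] [MeasurableSpace F] [BorelSpace F] in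
/-- **the second-degree factor is lattice-periodic on a box**: for `c` bounded by `q^{e₀}` (`c(𝔭ᵃ)^ι ⊆ (𝔭^{a-e₀})^ι`),
`x ∈ (𝔭^L)^ι` and `h ∈ (𝔭^{L'})^ι` with `L'` deep enough, `½⟨x+h, c(x+h)⟩ - ½⟨x, cx⟩ ∈ 𝔭^m`.
[cite: Weil1964, Chap. II n° 27, p. 175] -/
theorem halfForm_add_sub_mem_primePowBall {e₀ k₂ L L' : ℤ} {m : ℤ} (hk₂ : (⅟(2 : F)) ∈ primePowBall F k₂)
    (hLL' : L ≤ L') (hL' : m + e₀ - L - k₂ ≤ L') (c : (ι → F) →ₗ[F] (ι → F))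
    (hc : ∀ (a : ℤ) (x : ι → F), x ∈ primePowPiBox F ι a → c x ∈ primePowPiBox F ι (a - e₀))
    {x h : ι → F} (hx : x ∈ primePowPiBox F ι L) (hh : h ∈ primePowPiBox F ι L') :
    halfForm c (x + h) - halfForm c x ∈ primePowBall F m := by
  have e : halfForm c (x + h) - halfForm c x = ⅟(2 : F) * (x ⬝ᵥ c h + h ⬝ᵥ c x + h ⬝ᵥ c h) := by
    rw [halfForm_apply, halfForm_apply, ← mul_sub, dotProduct_map_add_sub]
  rw [e]
  have h1 : x ⬝ᵥ c h ∈ primePowBall F (L + (L' - e₀)) := dotProduct_mem_primePowBall hx (hc L' h hh)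
  have h2 : h ⬝ᵥ c x ∈ primePowBall F (L' + (L - e₀)) := dotProduct_mem_primePowBall hh (hc L x hx)
  have h3 : h ⬝ᵥ c h ∈ primePowBall F (L' + (L' - e₀)) := dotProduct_mem_primePowBall hh (hc L' h hh)
  have hs : x ⬝ᵥ c h + h ⬝ᵥ c x + h ⬝ᵥ c h ∈ primePowBall F (L + L' - e₀) := by
    refine add_mem_primePowBall (add_mem_primePowBall ?_ ?_) ?_
    · exact primePowBall_antitone (by omega) h1
    · exact primePowBall_antitone (by omega) h2
    · exact primePowBall_antitone (by omega) h3
  exact primePowBall_antitone (by omega) (mul_mem_primePowBall hk₂ hs)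

omit [DecidableEq ι] [Invertible (2 : F)] [MeasurableSpace F] [BorelSpace F] in
/-- **the bilinear factor is lattice-periodic on a box**: `⟨y, c(x+h)⟩ - ⟨y, cx⟩ = ⟨y, ch⟩ ∈ 𝔭^m` for
`y ∈ (𝔭^L)^ι`, `h ∈ (𝔭^{L'})^ι`, `L'` deep enough. [cite: Weil1964, Chap. II n° 27, p. 175] -/
theorem dotProduct_map_add_sub_mem_primePowBall {e₀ L L' : ℤ} {m : ℤ} (hL' : m + e₀ - L ≤ L')
    (c : (ι → F) →ₗ[F] (ι → F))
    (hc : ∀ (a : ℤ) (x : ι → F), x ∈ primePowPiBox F ι a → c x ∈ primePowPiBox F ι (a - e₀))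
    {x y h : ι → F} (hy : y ∈ primePowPiBox F ι L) (hh : h ∈ primePowPiBox F ι L') :
    y ⬝ᵥ c (x + h) - y ⬝ᵥ c x ∈ primePowBall F m := by
  rw [map_add, dotProduct_add, add_sub_cancel_left]
  exact primePowBall_antitone (by omega) (dotProduct_mem_primePowBall hy (hc L' h hh))

omit [DecidableEq ι] [Invertible (2 : F)] [MeasurableSpace F] [BorelSpace F] in
/-- **… and in the other variable**: `⟨y + h, cx⟩ - ⟨y, cx⟩ = ⟨h, cx⟩ ∈ 𝔭^m` for `x ∈ (𝔭^L)^ι`, `h ∈ (𝔭^{L'})^ι`.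
[cite: Weil1964, Chap. II n° 27, p. 175] -/
theorem add_dotProduct_map_sub_mem_primePowBall {e₀ L L' : ℤ} {m : ℤ} (hL' : m + e₀ - L ≤ L')
    (c : (ι → F) →ₗ[F] (ι → F))
    (hc : ∀ (a : ℤ) (x : ι → F), x ∈ primePowPiBox F ι a → c x ∈ primePowPiBox F ι (a - e₀))
    {x y h : ι → F} (hx : x ∈ primePowPiBox F ι L) (hh : h ∈ primePowPiBox F ι L') :
    (y + h) ⬝ᵥ c x - y ⬝ᵥ c x ∈ primePowBall F m := by
  rw [add_dotProduct, add_sub_cancel_left]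
  exact primePowBall_antitone (by omega) (dotProduct_mem_primePowBall hh (hc L x hx))

omit [DecidableEq ι] [Invertible (2 : F)] [MeasurableSpace F] [BorelSpace F] [Fintype ι] in
/-- `ψ(a) = ψ(b)` as soon as `a - b` lies in the conductor ball `𝔭^m`. [cite: Weil1964, Chap. II n° 27, p. 175] -/
theorem addChar_eq_of_sub_mem (hm : ψ.HasConductorExp m) {a b : F}
    (h : a - b ∈ primePowBall F m) : ψ a = ψ b := by
  have : ψ a = ψ (b + (a - b)) := by rw [add_sub_cancel]
  rw [this, AddChar.map_add_eq_mul, hm.1 _ h, mul_one]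

end Kernel

/-! ## §2 Box function spaces: support in `(𝔭^L)^ι`, periods `(𝔭^{L'})^ι` -/

section Box

variable {F : Type*} [Field F] [ValuativeRel F] [TopologicalSpace F] [IsNonarchimedeanLocalField F]
  {ι : Type*} [Fintype ι]

omit [Fintype ι] in
/-- a coset of the box lattice is a translate of it: `Π(aᵢ + 𝔭^ℓ) = a + (𝔭^ℓ)^ι`. [cite: Weil1964, Chap. II n° 27, p. 174] -/
theorem piCoset_eq_vadd (a : ι → F) (ℓ : ℤ) : piCoset F a ℓ = a +ᵥ piPrimePowBall F ι ℓ := by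
  ext x
  rw [mem_piCoset_iff_sub_mem, mem_vadd_piPrimePowBall_iff]
  rfl

/-- the indicator of a coset of the box lattice is Schwartz–Bruhat. [cite: WeilBNT1967, Ch. VII §2, Def. 1] -/
theorem indicator_piCoset_mem_schwartzBruhat (a : ι → F) (ℓ : ℤ) :
    (piCoset F a ℓ).indicator (fun _ => (1 : ℂ)) ∈ SchwartzBruhat (ι → F) := by
  rw [piCoset_eq_vadd]
  exact indicator_vadd_piPrimePowBall_mem_schwartzBruhat ℓ a 1

omit [Fintype ι] in
/-- a coset through a point of the box `(𝔭^L)^ι`, of a deeper lattice `(𝔭^{L'})^ι`, stays in the box.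
[cite: Weil1964, Chap. II n° 27, p. 174] -/
theorem piCoset_subset_primePowPiBox {L L' : ℤ} (hLL' : L ≤ L') {a : ι → F} (ha : a ∈ primePowPiBox F ι L) :
    piCoset F a L' ⊆ primePowPiBox F ι L := by
  intro x hx
  obtain ⟨h, hh, rfl⟩ := exists_eq_add_of_mem_piCoset hx
  exact add_mem_primePowPiBox ha (primePowPiBox_antitone hLL' hh)

omit [Fintype ι] in
/-- **box functions are finite combinations of coset indicators**: a function supported on `(𝔭^L)^ι` and
`(𝔭^{L'})^ι`-periodic equals `Σ_{B ∈ C} f(a_B) 𝟙_B` for any finite disjoint family `C` of `(𝔭^{L'})^ι`-cosets through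
points `a_B` of the box covering it. [cite: Weil1964, Chap. II n° 27, p. 175] -/
theorem eq_sum_indicator_of_box {L L' : ℤ} (hLL' : L ≤ L') {C : Finset (Set (ι → F))} {a : Set (ι → F) → (ι → F)}
    (hC : ∀ B ∈ C, a B ∈ primePowPiBox F ι L ∧ B = piCoset F (a B) L')
    (hCdisj : (↑C : Set (Set (ι → F))).PairwiseDisjoint (fun B => B))
    (hcov : primePowPiBox F ι L = ⋃ B ∈ C, B) {f : (ι → F) → ℂ}
    (hf0 : ∀ x ∉ primePowPiBox F ι L, f x = 0) (hfp : ∀ x, ∀ h ∈ primePowPiBox F ι L', f (x + h) = f x)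
    (x : ι → F) : f x = ∑ B ∈ C, f (a B) * B.indicator (fun _ => (1 : ℂ)) x := by
  classical
  by_cases hx : x ∈ primePowPiBox F ι L
  · -- `x` lies in exactly one coset `B₀ ∈ C`
    have hx' : x ∈ ⋃ B ∈ C, B := hcov ▸ hx
    obtain ⟨B₀, hB₀, hxB₀⟩ := Set.mem_iUnion₂.1 hx'
    rw [Finset.sum_eq_single B₀]
    · rw [Set.indicator_of_mem hxB₀, mul_one]
      obtain ⟨-, hB₀eq⟩ := hC B₀ hB₀
      rw [hB₀eq] at hxB₀
      obtain ⟨h, hh, rfl⟩ := exists_eq_add_of_mem_piCoset hxB₀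
      rw [hfp _ h hh]
    · intro B hB hne
      have hxB : x ∉ B := fun h => hne (hCdisj.elim (Finset.mem_coe.2 hB) (Finset.mem_coe.2 hB₀)
        (Set.not_disjoint_iff.2 ⟨x, h, hxB₀⟩))
      rw [Set.indicator_of_notMem hxB, mul_zero]
    · intro h; exact absurd hB₀ h
  · rw [hf0 x hx]
    symm
    refine Finset.sum_eq_zero fun B hB => ?_
    have hxB : x ∉ B := by
      intro h
      have h' : x ∈ piCoset F (a B) L' := (hC B hB).2 ▸ h
      exact hx (piCoset_subset_primePowPiBox hLL' (hC B hB).1 h')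
    rw [Set.indicator_of_notMem hxB, mul_zero]

/-- **coset decomposition of a box**: for `L ≤ L'` the box `(𝔭^L)^ι` is a finite disjoint union of cosets of
`(𝔭^{L'})^ι` through points of the box. [cite: Weil1964, Chap. II n° 27, p. 175] -/
theorem exists_coset_decomposition {L L' : ℤ} (hLL' : L ≤ L') :
    ∃ (C : Finset (Set (ι → F))) (a : Set (ι → F) → (ι → F)),
      (∀ B ∈ C, a B ∈ primePowPiBox F ι L ∧ B = piCoset F (a B) L') ∧
        (↑C : Set (Set (ι → F))).PairwiseDisjoint (fun B => B) ∧ primePowPiBox F ι L = ⋃ B ∈ C, B := by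
  obtain ⟨C, hC, hCdisj, hcov⟩ := exists_finset_piCosets (F := F) (ι := ι) (ℓ := L')
    (isCompact_primePowPiBox L) (fun x hx h hh => add_mem_primePowPiBox hx (primePowPiBox_antitone hLL' hh))
  choose! a ha using hC
  exact ⟨C, a, fun B hB => ha B hB, hCdisj, hcov⟩

/-- **a finite-dimensional space of Schwartz–Bruhat functions lives in one box**: there are `L, L_p` with every
member supported on `(𝔭^L)^ι` and `(𝔭^{L_p})^ι`-periodic. [cite: WeilBNT1967, Ch. VII §2, Prop. 2] -/
theorem exists_box_of_finiteDimensional (W : Submodule ℂ (SchwartzBruhat (ι → F))) [FiniteDimensional ℂ W] :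
    ∃ L Lp : ℤ, ∀ w ∈ W, (∀ x ∉ primePowPiBox F ι L, (w : (ι → F) → ℂ) x = 0) ∧
      ∀ x, ∀ h ∈ primePowPiBox F ι Lp, (w : (ι → F) → ℂ) (x + h) = (w : (ι → F) → ℂ) x := by
  classical
  haveI : Module.Free ℂ W := Module.Free.of_divisionRing ℂ W
  let b := Module.finBasis ℂ W
  -- box data of the basis vectors
  have hsupp : ∀ i, ∃ N : ℤ, ∀ x ∉ primePowPiBox F ι N, ((b i : W) : (ι → F) → ℂ) x = 0 := fun i =>
    exists_eq_zero_of_notMem_piPrimePowBall ((b i : W) : SchwartzBruhat (ι → F)).2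
  have hper : ∀ i, ∃ N : ℤ, ∀ x, ∀ h ∈ primePowPiBox F ι N,
      ((b i : W) : (ι → F) → ℂ) (x + h) = ((b i : W) : (ι → F) → ℂ) x := fun i =>
    exists_forall_add_eq_of_mem_schwartzBruhat_pi ((b i : W) : SchwartzBruhat (ι → F)).2
  choose N hN using hsupp
  choose N' hN' using hper
  obtain ⟨L, hL⟩ := (Finset.univ.image N).bddBelow
  obtain ⟨Lp, hLp⟩ := (Finset.univ.image N').bddAbove
  have hLi : ∀ i, L ≤ N i := fun i => hL (Finset.mem_coe.2 (Finset.mem_image_of_mem N (Finset.mem_univ i)))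
  have hLpi : ∀ i, N' i ≤ Lp := fun i => hLp (Finset.mem_coe.2 (Finset.mem_image_of_mem N' (Finset.mem_univ i)))
  refine ⟨L, Lp, fun w hw => ?_⟩
  -- expand `w` on the basis
  have hexp : (w : (ι → F) → ℂ) = fun x => ∑ i, b.repr ⟨w, hw⟩ i * ((b i : W) : (ι → F) → ℂ) x := by
    have e1 : (⟨w, hw⟩ : W) = ∑ i, b.repr ⟨w, hw⟩ i • b i := (b.sum_repr ⟨w, hw⟩).symm
    have e2 : w = ∑ i, b.repr ⟨w, hw⟩ i • ((b i : W) : SchwartzBruhat (ι → F)) := by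
      have := congrArg (Subtype.val : W → SchwartzBruhat (ι → F)) e1
      simpa only [AddSubmonoidClass.coe_finsetSum, Submodule.coe_smul] using this
    funext x
    have := congrArg (fun g : SchwartzBruhat (ι → F) => (g : (ι → F) → ℂ) x) e2
    simpa only [AddSubmonoidClass.coe_finsetSum, Submodule.coe_smul, Finset.sum_apply, Pi.smul_apply,
      smul_eq_mul] using this
  refine ⟨fun x hx => ?_, fun x h hh => ?_⟩
  · rw [hexp]
    refine Finset.sum_eq_zero fun i _ => ?_
    rw [hN i x (fun hx' => hx (primePowPiBox_antitone (hLi i) hx')), mul_zero]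
  · rw [hexp]
    refine Finset.sum_congr rfl fun i _ => ?_
    rw [hN' i x h (primePowPiBox_antitone (hLpi i) hh)]

variable [MeasurableSpace F] [BorelSpace F] (μ : Measure F) [μ.IsAddHaarMeasure]

omit [μ.IsAddHaarMeasure] in
/-- **trace of a kernel operator on a box space = integral of the diagonal**: `U` = Schwartz–Bruhat functions
supported on `B = (𝔭^L)^ι` and `Λ = (𝔭^{L'})^ι`-periodic, `A` an operator of `𝒮(F^ι)` preserving `U` and given on
`U` by a kernel `k` which is `Λ`-invariant in the first variable on `B × B`: `tr(A|U) = ∫_B k(x,x) dx` (matrix of `A`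
in the coset indicators; its diagonal entries are `∫_{coset} k(a,y) dy = ∫_{coset} k(y,y) dy`).
[cite: Weil1964, Chap. II n° 27, p. 175] -/
theorem trace_restrict_boxSpace_eq_setIntegral_diag {L L' : ℤ} (hLL' : L ≤ L') (U : Submodule ℂ (SchwartzBruhat (ι → F)))
    [FiniteDimensional ℂ U]
    (hU : ∀ f : SchwartzBruhat (ι → F), f ∈ U ↔
      (∀ x ∉ primePowPiBox F ι L, (f : (ι → F) → ℂ) x = 0) ∧
        ∀ x, ∀ h ∈ primePowPiBox F ι L', (f : (ι → F) → ℂ) (x + h) = (f : (ι → F) → ℂ) x)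
    (A : SchwartzBruhat (ι → F) →ₗ[ℂ] SchwartzBruhat (ι → F)) (hA : ∀ f ∈ U, A f ∈ U) (k : (ι → F) → (ι → F) → ℂ)
    (hkx : ∀ x ∈ primePowPiBox F ι L, ∀ y ∈ primePowPiBox F ι L, ∀ h ∈ primePowPiBox F ι L', k (x + h) y = k x y)
    (hkd : IntegrableOn (fun x => k x x) (primePowPiBox F ι L) (Measure.pi fun _ : ι => μ))
    (hAk : ∀ f ∈ U, ∀ x ∈ primePowPiBox F ι L,
      (A f : (ι → F) → ℂ) x = ∫ y in primePowPiBox F ι L, k x y * (f : (ι → F) → ℂ) y ∂(Measure.pi fun _ : ι => μ)) :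
    LinearMap.trace ℂ U (A.restrict hA) = ∫ x in primePowPiBox F ι L, k x x ∂(Measure.pi fun _ : ι => μ) := by
  classical
  haveI : SecondCountableTopology F := secondCountableTopology_localField F
  haveI : Module.Free ℂ U := Module.Free.of_divisionRing ℂ U
  obtain ⟨C, a, hC, hCdisj, hcov⟩ := exists_coset_decomposition (F := F) (ι := ι) hLL'
  -- the coset indicators `e a₀ = 𝟙_{Π(a₀ᵢ + 𝔭^{L'})}`
  let e : (ι → F) → SchwartzBruhat (ι → F) := fun a₀ =>
    ⟨(piCoset F a₀ L').indicator (fun _ => (1 : ℂ)), indicator_piCoset_mem_schwartzBruhat a₀ L'⟩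
  have he : ∀ a₀ x, (e a₀ : (ι → F) → ℂ) x = (piCoset F a₀ L').indicator (fun _ => (1 : ℂ)) x := fun _ _ => rfl
  have hemem : ∀ a₀ ∈ primePowPiBox F ι L, e a₀ ∈ U := by
    intro a₀ ha₀
    rw [hU]
    refine ⟨fun x hx => ?_, fun x h hh => ?_⟩
    · rw [he]; exact Set.indicator_of_notMem (fun h => hx (piCoset_subset_primePowPiBox hLL' ha₀ h)) _
    rw [he, he]
    by_cases hxB : x ∈ piCoset F a₀ L'
    · rw [Set.indicator_of_mem hxB, Set.indicator_of_mem]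
      rw [mem_piCoset_iff_sub_mem] at hxB ⊢
      rw [add_sub_right_comm]
      exact add_mem_primePowPiBox hxB hh
    · rw [Set.indicator_of_notMem hxB, Set.indicator_of_notMem]
      intro hx'
      apply hxB
      rw [mem_piCoset_iff_sub_mem] at hx' ⊢
      have : x - a₀ = (x + h - a₀) - h := by ring
      rw [this]
      exact sub_mem_primePowPiBox hx' hh
  -- members of `U` expand along the coset indicators
  have hdec : ∀ f ∈ U, (f : SchwartzBruhat (ι → F)) = ∑ B : C, ((f : (ι → F) → ℂ) (a B)) • e (a B) := by
    intro f hf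
    apply Subtype.ext
    funext x
    rw [eq_sum_indicator_of_box hLL' hC hCdisj hcov ((hU f).1 hf).1 ((hU f).1 hf).2 x,
      AddSubmonoidClass.coe_finsetSum, Finset.sum_apply, ← Finset.sum_coe_sort C]
    refine Finset.sum_congr rfl fun B _ => ?_
    rw [Submodule.coe_smul, Pi.smul_apply, smul_eq_mul, he, ← (hC B B.2).2]
  -- the rank-one decomposition of `A|U`
  let ê : C → U := fun B => ⟨e (a B), hemem (a B) (hC B B.2).1⟩
  let φ : C → (U →ₗ[ℂ] ℂ) := fun B =>
    (LinearMap.proj (a (B : Set (ι → F))) : ((ι → F) → ℂ) →ₗ[ℂ] ℂ) ∘ₗ (SchwartzBruhat (ι → F)).subtype ∘ₗ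
      U.subtype ∘ₗ A.restrict hA
  have hφ : ∀ (B : C) (f : U), φ B f = ((A f : SchwartzBruhat (ι → F)) : (ι → F) → ℂ) (a B) := fun B f => rfl
  have hArk : A.restrict hA = ∑ B : C, (φ B).smulRight (ê B) := by
    apply LinearMap.ext
    intro f
    apply Subtype.ext
    rw [LinearMap.restrict_apply, LinearMap.coe_sum, Finset.sum_apply, AddSubmonoidClass.coe_finsetSum]
    simp only [LinearMap.smulRight_apply, Submodule.coe_smul, hφ]
    exact hdec (A f) (hA f f.2)
  rw [hArk, map_sum]
  have htr : ∀ B : C, LinearMap.trace ℂ U ((φ B).smulRight (ê B)) = φ B (ê B) := fun B =>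
    LinearMap.trace_smulRight (R := ℂ) (M := U) (φ B) (ê B)
  simp only [htr, hφ]
  -- each diagonal term is the integral of the diagonal of the kernel over the coset
  have hterm : ∀ B : C, ((A (ê B : SchwartzBruhat (ι → F)) : SchwartzBruhat (ι → F)) : (ι → F) → ℂ) (a B) =
      ∫ y in (B : Set (ι → F)), k y y ∂(Measure.pi fun _ : ι => μ) := by
    intro B
    obtain ⟨haB, hBeq⟩ := hC B B.2
    set a₀ : ι → F := a (B : Set (ι → F)) with ha₀
    have hBsub : (B : Set (ι → F)) ⊆ primePowPiBox F ι L := hBeq ▸ piCoset_subset_primePowPiBox hLL' haB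
    have hBmeas : MeasurableSet (B : Set (ι → F)) := hBeq ▸ measurableSet_piCoset a₀ L'
    show ((A (e a₀) : SchwartzBruhat (ι → F)) : (ι → F) → ℂ) a₀ = _
    rw [hAk _ (hemem _ haB) _ haB]
    have h1 : (fun y => k a₀ y * (e a₀ : (ι → F) → ℂ) y) = (B : Set (ι → F)).indicator (k a₀) := by
      funext y
      rw [he, ← hBeq]
      by_cases hy : y ∈ (B : Set (ι → F))
      · rw [Set.indicator_of_mem hy, Set.indicator_of_mem hy, mul_one]
      · rw [Set.indicator_of_notMem hy, Set.indicator_of_notMem hy, mul_zero]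
    rw [h1, setIntegral_indicator hBmeas, Set.inter_eq_right.2 hBsub]
    refine setIntegral_congr_fun hBmeas fun y hy => ?_
    have hy' : y ∈ piCoset F a₀ L' := hBeq ▸ hy
    obtain ⟨h, hh, rfl⟩ := exists_eq_add_of_mem_piCoset hy'
    have hmem : a₀ + h ∈ (B : Set (ι → F)) := by rw [hBeq]; exact add_mem_piCoset hh
    exact (hkx a₀ haB (a₀ + h) (hBsub hmem) h hh).symm
  rw [Finset.sum_congr rfl fun B _ => hterm B,
    Finset.sum_coe_sort C (fun B => ∫ y in B, k y y ∂(Measure.pi fun _ : ι => μ))]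
  -- reassemble the box
  conv_rhs => rw [hcov]
  refine (integral_biUnion_finset C (fun B hB => (hC B hB).2 ▸ measurableSet_piCoset (a B) L') hCdisj
    (fun B hB => hkd.mono_set ?_)).symm
  intro z hz
  rw [hcov]
  exact Set.mem_biUnion hB hz

end Box

/-! ## §3 Averaging over a finite quotient of the acting group -/

section Average

variable {G : Type*} [Group G] {S : Type*} [AddCommGroup S] [Module ℂ S] (ω : Representation ℂ G S)
  (K : Subgroup G) (H : Subgroup K) [Fintype (K ⧸ H)]

/-- **the averaging operator `P = [K:H]⁻¹ Σ_{q ∈ K/H} ω(q̃)` fixes the `K`-fixed vectors.**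
[cite: BernsteinZelevinsky1976, §2.1] -/
theorem average_apply_of_fixed (w : S) (hw : ∀ k ∈ K, ω k w = w) :
    ((Fintype.card (K ⧸ H) : ℂ)⁻¹ • ∑ q : K ⧸ H, ω ((q.out : K) : G)) w = w := by
  rw [LinearMap.smul_apply, LinearMap.coe_sum, Finset.sum_apply]
  have : ∀ q : K ⧸ H, ω ((q.out : K) : G) w = w := fun q => hw _ (q.out : K).2
  simp only [this, Finset.sum_const, Finset.card_univ, ← Nat.cast_smul_eq_nsmul ℂ, smul_smul]
  rw [inv_mul_cancel₀ (Nat.cast_ne_zero.2 Fintype.card_ne_zero), one_smul]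

/-- **… and maps every `H`-fixed vector to a `K`-fixed vector** (left multiplication by `k ∈ K` permutes `K/H`,
and the representatives change by elements of `H`). [cite: BernsteinZelevinsky1976, §2.1] -/
theorem apply_average_of_fixed (u : S) (hu : ∀ h ∈ H, ω ((h : K) : G) u = u) (k : G) (hk : k ∈ K) :
    ω k (((Fintype.card (K ⧸ H) : ℂ)⁻¹ • ∑ q : K ⧸ H, ω ((q.out : K) : G)) u) =
      ((Fintype.card (K ⧸ H) : ℂ)⁻¹ • ∑ q : K ⧸ H, ω ((q.out : K) : G)) u := by
  rw [LinearMap.smul_apply, LinearMap.coe_sum, Finset.sum_apply, map_smul, map_sum]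
  congr 1
  set k' : K := ⟨k, hk⟩ with hk'
  have hterm : ∀ q : K ⧸ H, ω k (ω ((q.out : K) : G) u) = ω (((k' • q).out : K) : G) u := by
    intro q
    obtain ⟨h, hh⟩ := QuotientGroup.mk_out_eq_mul H (k' * q.out)
    have hmk : (QuotientGroup.mk (k' * q.out) : K ⧸ H) = k' • q := by
      rw [← smul_eq_mul, ← MulAction.Quotient.smul_mk, QuotientGroup.out_eq']
    rw [← hmk, hh, Subgroup.coe_mul, Subgroup.coe_mul, map_mul, map_mul, Module.End.mul_apply, Module.End.mul_apply,
      hu h h.2]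
  simp only [hterm]
  exact Fintype.sum_equiv (MulAction.toPerm k') _ (fun q : K ⧸ H => ω ((q.out : K) : G) u) fun q => rfl

end Average

/-! ## §4 The trace of `ω(z₀)` on the `K`-fixed vectors -/

section Main

variable {F : Type*} [Field F] [ValuativeRel F] [TopologicalSpace F] [IsNonarchimedeanLocalField F]
  {ι : Type*} [Fintype ι] [DecidableEq ι] [Invertible (2 : F)]
  {ψ : AddChar F Circle} (hl : IsLocallyConstant (⇑ψ : F → Circle))
  [MeasurableSpace F] [BorelSpace F] (μ : Measure F) [μ.IsAddHaarMeasure] {m : ℤ}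

omit [ValuativeRel F] [IsNonarchimedeanLocalField F] [Fintype ι] [DecidableEq ι] [Invertible (2 : F)]
  [MeasurableSpace F] [BorelSpace F] in
include hl in
/-- the character into `ℂ` is continuous (it is locally constant). [cite: Weil1964, n° 13, p. 160] -/
theorem continuous_addChar_coe : Continuous fun t : F => ((ψ t : Circle) : ℂ) :=
  continuous_subtype_val.comp hl.continuous

omit [ValuativeRel F] [TopologicalSpace F] [IsNonarchimedeanLocalField F] [DecidableEq ι] [MeasurableSpace F]
  [BorelSpace F] in
/-- the diagonal of the word kernel is a second-degree character: `ψ(-½⟨x,γx⟩) ψ(⟨x,B⁻¹x⟩) ψ(-½⟨x,δx⟩) =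
ψ(⟨x,B⁻¹x⟩ - ½⟨x,γx⟩ - ½⟨x,δx⟩)`. [cite: Weil1964, n° 13 (29), p. 160] -/
theorem kernel_diag_eq (γ δ : (ι → F) →ₗ[F] (ι → F)) (B : (ι → F) ≃ₗ[F] (ι → F)) (x : ι → F) :
    ((ψ (-halfForm γ x) : Circle) : ℂ) * ((((ψ (x ⬝ᵥ B.symm x)) : Circle) : ℂ) * (((ψ (-halfForm δ x)) : Circle) : ℂ)) =
      ((ψ (x ⬝ᵥ B.symm x - halfForm γ x - halfForm δ x) : Circle) : ℂ) := by
  rw [show x ⬝ᵥ B.symm x - halfForm γ x - halfForm δ x = -halfForm γ x + (x ⬝ᵥ B.symm x + -halfForm δ x) by ring,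
    AddChar.map_add_eq_mul, AddChar.map_add_eq_mul, Circle.coe_mul, Circle.coe_mul]

omit [DecidableEq ι] in
/-- **finite-level trace of a big-cell family on the fixed vectors.**  Let `ω` be a representation of a group `G`
on `𝒮(F^ι)`, `K ≤ G`, `z₀ ∈ G`; assume (W1) on the coset `z₀K` the operators are canonical words with a common
kernel prefactor `c` (`ω(z₀k) = (c|det B_k|^{1/2}) · r(n(γ_k)) r(m(B_k)) r(w) r(n(δ_k))`), (W2) the Gauss integrals
of the diagonal second-degree characters over every deep box `(𝔭ⁿ)^ι`, `n ≤ m₀`, have the common value `Gv`,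
(W3) `γ_k, B_k⁻¹, δ_k` are uniformly bounded by `q^{e₀}`, (W4) every Schwartz–Bruhat function is fixed by a
finite-index subgroup of `K`.  Then on the (finite-dimensional) space `W` of `ω(K)`-fixed vectors
`tr(ω(z₀)|W) = c · Gv` — [Howe1973]'s character formula for the oscillator representation, read at finite level.
[cite: Weil1964, n° 13 (29) p. 160, Chap. II n° 27 p. 175; MoeglinVignerasWaldspurger1987, Chap. 2 II.2, II.8] -/
theorem trace_restrict_fixed_eq_of_bigCell_family (hψ : ψ.IsContinuousNontrivial) (hm : ψ.HasConductorExp m)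
    {G : Type*} [Group G] (ω : Representation ℂ G (SchwartzBruhat (ι → F))) (K : Subgroup G) (z₀ : G)
    (γ_ δ_ : G → ((ι → F) →ₗ[F] (ι → F))) (B_ : G → ((ι → F) ≃ₗ[F] (ι → F))) (c Gv : ℂ) (m₀ e₀ : ℤ)
    (hW1 : ∀ k ∈ K, ∀ f : SchwartzBruhat (ι → F),
      ω (z₀ * k) f = (c * (modSqrt (B_ k) : ℂ)) •
        ((unipOpPi hl (γ_ k) * leviOpPi (B_ k) * fourierOpPi μ hψ hm * unipOpPi hl (δ_ k) :
          SchwartzBruhat (ι → F) ≃ₗ[ℂ] SchwartzBruhat (ι → F)) f))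
    (hW2 : ∀ k ∈ K, ∀ n ≤ m₀,
      ∫ x in primePowPiBox F ι n,
        ((ψ (x ⬝ᵥ (B_ k).symm x - halfForm (γ_ k) x - halfForm (δ_ k) x) : Circle) : ℂ)
          ∂(Measure.pi fun _ : ι => μ) = Gv)
    (hW3 : ∀ k ∈ K, ∀ (a : ℤ) (x : ι → F), x ∈ primePowPiBox F ι a →
      γ_ k x ∈ primePowPiBox F ι (a - e₀) ∧ (B_ k).symm x ∈ primePowPiBox F ι (a - e₀) ∧
        δ_ k x ∈ primePowPiBox F ι (a - e₀))
    (hW4 : ∀ f : SchwartzBruhat (ι → F), ∃ K₁ : Subgroup G, K₁ ≤ K ∧ (K₁.subgroupOf K).FiniteIndex ∧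
      ∀ k ∈ K₁, ω k f = f)
    (W : Submodule ℂ (SchwartzBruhat (ι → F))) [FiniteDimensional ℂ W]
    (hWK : ∀ f, f ∈ W ↔ ∀ k ∈ K, ω k f = f) (hW : ∀ w ∈ W, ω z₀ w ∈ W) :
    LinearMap.trace ℂ W ((ω z₀).restrict hW) = c * Gv := by
  classical
  haveI : SecondCountableTopology F := secondCountableTopology_localField F
  -- (a) one box for `W`; the constants
  obtain ⟨L₀, Lp, hbox⟩ := exists_box_of_finiteDimensional W
  obtain ⟨k₂, hk₂'⟩ := exists_normAbs_eq_inv_zpow (Invertible.ne_zero (⅟(2 : F)))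
  have hk₂ : (⅟(2 : F)) ∈ primePowBall F k₂ := mem_primePowBall_iff.2 hk₂'.le
  set L : ℤ := min L₀ m₀ with hLdef
  set L' : ℤ := max (max L Lp) (max (m + e₀ - L - k₂) (m + e₀ - L)) with hL'def
  have hLL' : L ≤ L' := (le_max_left _ _).trans (le_max_left _ _)
  have hLpL' : Lp ≤ L' := (le_max_right _ _).trans (le_max_left _ _)
  have hL'₁ : m + e₀ - L - k₂ ≤ L' := (le_max_left _ _).trans (le_max_right _ _)
  have hL'₂ : m + e₀ - L ≤ L' := (le_max_right _ _).trans (le_max_right _ _)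
  have hLm₀ : L ≤ m₀ := min_le_right _ _
  have hLL₀ : L ≤ L₀ := min_le_left _ _
  -- (b) the box space `U ⊇ W`
  let U : Submodule ℂ (SchwartzBruhat (ι → F)) :=
    { carrier := {f | (∀ x ∉ primePowPiBox F ι L, (f : (ι → F) → ℂ) x = 0) ∧
        ∀ x, ∀ h ∈ primePowPiBox F ι L', (f : (ι → F) → ℂ) (x + h) = (f : (ι → F) → ℂ) x}
      add_mem' := by
        rintro f g ⟨hf0, hfp⟩ ⟨hg0, hgp⟩
        refine ⟨fun x hx => ?_, fun x h hh => ?_⟩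
        · rw [Submodule.coe_add, Pi.add_apply, hf0 x hx, hg0 x hx, add_zero]
        · rw [Submodule.coe_add, Pi.add_apply, Pi.add_apply, hfp x h hh, hgp x h hh]
      zero_mem' := ⟨fun x _ => rfl, fun x h _ => rfl⟩
      smul_mem' := by
        rintro r f ⟨hf0, hfp⟩
        refine ⟨fun x hx => ?_, fun x h hh => ?_⟩
        · rw [Submodule.coe_smul, Pi.smul_apply, hf0 x hx, smul_zero]
        · rw [Submodule.coe_smul, Pi.smul_apply, Pi.smul_apply, hfp x h hh] }
  have hU : ∀ f : SchwartzBruhat (ι → F), f ∈ U ↔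
      (∀ x ∉ primePowPiBox F ι L, (f : (ι → F) → ℂ) x = 0) ∧
        ∀ x, ∀ h ∈ primePowPiBox F ι L', (f : (ι → F) → ℂ) (x + h) = (f : (ι → F) → ℂ) x := fun f => Iff.rfl
  have hWU : W ≤ U := fun w hw =>
    ⟨fun x hx => (hbox w hw).1 x (fun h => hx (primePowPiBox_antitone hLL₀ h)),
      fun x h hh => (hbox w hw).2 x h (primePowPiBox_antitone hLpL' hh)⟩
  -- (c) coset indicators span `U`
  obtain ⟨C, a, hC, hCdisj, hcov⟩ := exists_coset_decomposition (F := F) (ι := ι) hLL'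
  let e : (ι → F) → SchwartzBruhat (ι → F) := fun a₀ =>
    ⟨(piCoset F a₀ L').indicator (fun _ => (1 : ℂ)), indicator_piCoset_mem_schwartzBruhat a₀ L'⟩
  have he : ∀ a₀ x, (e a₀ : (ι → F) → ℂ) x = (piCoset F a₀ L').indicator (fun _ => (1 : ℂ)) x := fun _ _ => rfl
  have hdecU : ∀ f ∈ U, (f : SchwartzBruhat (ι → F)) = ∑ B : C, ((f : (ι → F) → ℂ) (a B)) • e (a B) := by
    intro f hf
    apply Subtype.ext
    funext x
    rw [eq_sum_indicator_of_box hLL' hC hCdisj hcov ((hU f).1 hf).1 ((hU f).1 hf).2 x,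
      AddSubmonoidClass.coe_finsetSum, Finset.sum_apply, ← Finset.sum_coe_sort C]
    refine Finset.sum_congr rfl fun B _ => ?_
    rw [Submodule.coe_smul, Pi.smul_apply, smul_eq_mul, he, ← (hC B B.2).2]
  haveI : FiniteDimensional ℂ U := by
    have hle : U ≤ Submodule.span ℂ (Set.range fun B : C => e (a B)) := fun f hf => by
      rw [hdecU f hf]
      exact Submodule.sum_mem _ fun B _ => Submodule.smul_mem _ _ (Submodule.subset_span ⟨B, rfl⟩)
    haveI : FiniteDimensional ℂ (Submodule.span ℂ (Set.range fun B : C => e (a B))) :=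
      FiniteDimensional.span_of_finite ℂ (Set.finite_range _)
    exact Submodule.finiteDimensional_of_le hle
  -- (d) a finite-index `H ≤ K` fixing `U` pointwise
  choose K₁ hK₁K hK₁fi hK₁fix using fun B : C => hW4 (e (a B))
  let H : Subgroup K := ⨅ B : C, (K₁ B).subgroupOf K
  haveI : H.FiniteIndex := Subgroup.finiteIndex_iInf fun B => hK₁fi B
  letI : Fintype (K ⧸ H) := Subgroup.fintypeQuotientOfFiniteIndex
  have hHfix : ∀ h ∈ H, ∀ u ∈ U, ω ((h : K) : G) u = u := by
    intro h hh u hu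
    rw [hdecU u hu, map_sum]
    refine Finset.sum_congr rfl fun B _ => ?_
    rw [map_smul, hK₁fix B _ (Subgroup.mem_subgroupOf.1 (Subgroup.mem_iInf.1 hh B))]
  -- (e) the averaging projector and the trace transfer
  set P : SchwartzBruhat (ι → F) →ₗ[ℂ] SchwartzBruhat (ι → F) :=
    (Fintype.card (K ⧸ H) : ℂ)⁻¹ • ∑ q : K ⧸ H, ω ((q.out : K) : G) with hPdef
  have hPW : ∀ w ∈ W, P w = w := fun w hw => average_apply_of_fixed ω K H w ((hWK w).1 hw)
  have hPU : ∀ u ∈ U, P u ∈ W := fun u hu =>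
    (hWK _).2 fun k hk => apply_average_of_fixed ω K H u (fun h hh => hHfix h hh u hu) k hk
  have hTP : ∀ u ∈ U, ω z₀ (P u) ∈ W := fun u hu => hW _ (hPU u hu)
  rw [trace_restrict_eq_trace_comp_average_restrict W U hWU (ω z₀) P hW hPW hTP]
  -- (f) the averaged kernel
  let kq : K ⧸ H → (ι → F) → (ι → F) → ℂ := fun q x y =>
    ((ψ (-halfForm (γ_ ((q.out : K) : G)) x) : Circle) : ℂ) *
      ((((ψ (y ⬝ᵥ (B_ ((q.out : K) : G)).symm x)) : Circle) : ℂ) *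
        (((ψ (-halfForm (δ_ ((q.out : K) : G)) y)) : Circle) : ℂ))
  let kf : (ι → F) → (ι → F) → ℂ := fun x y => (Fintype.card (K ⧸ H) : ℂ)⁻¹ * ∑ q : K ⧸ H, c * kq q x y
  have hqK : ∀ q : K ⧸ H, ((q.out : K) : G) ∈ K := fun q => (q.out : K).2
  -- lattice invariance of the kernel in the first variable on the box
  have hkx : ∀ x ∈ primePowPiBox F ι L, ∀ y ∈ primePowPiBox F ι L, ∀ h ∈ primePowPiBox F ι L',
      kf (x + h) y = kf x y := by
    intro x hx y hy h hh
    simp only [kf]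
    congr 1
    refine Finset.sum_congr rfl fun q _ => ?_
    congr 1
    simp only [kq]
    obtain ⟨hγb, hBb, hδb⟩ : (∀ (a : ℤ) (x : ι → F), x ∈ primePowPiBox F ι a →
        γ_ ((q.out : K) : G) x ∈ primePowPiBox F ι (a - e₀)) ∧
        (∀ (a : ℤ) (x : ι → F), x ∈ primePowPiBox F ι a →
          (((B_ ((q.out : K) : G)).symm : (ι → F) ≃ₗ[F] (ι → F)) : (ι → F) →ₗ[F] (ι → F)) x ∈
            primePowPiBox F ι (a - e₀)) ∧
        (∀ (a : ℤ) (x : ι → F), x ∈ primePowPiBox F ι a → δ_ ((q.out : K) : G) x ∈ primePowPiBox F ι (a - e₀)) :=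
      ⟨fun a x hx => (hW3 _ (hqK q) a x hx).1, fun a x hx => (hW3 _ (hqK q) a x hx).2.1,
        fun a x hx => (hW3 _ (hqK q) a x hx).2.2⟩
    have e1 : ψ (-halfForm (γ_ ((q.out : K) : G)) (x + h)) = ψ (-halfForm (γ_ ((q.out : K) : G)) x) := by
      refine addChar_eq_of_sub_mem hm ?_
      rw [show -halfForm (γ_ ((q.out : K) : G)) (x + h) - -halfForm (γ_ ((q.out : K) : G)) x =
        -(halfForm (γ_ ((q.out : K) : G)) (x + h) - halfForm (γ_ ((q.out : K) : G)) x) by ring]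
      exact neg_mem_primePowBall (halfForm_add_sub_mem_primePowBall hk₂ hLL' hL'₁ _ hγb hx hh)
    have e2 : ψ (y ⬝ᵥ (B_ ((q.out : K) : G)).symm (x + h)) = ψ (y ⬝ᵥ (B_ ((q.out : K) : G)).symm x) :=
      addChar_eq_of_sub_mem hm (dotProduct_map_add_sub_mem_primePowBall hL'₂
        (((B_ ((q.out : K) : G)).symm : (ι → F) ≃ₗ[F] (ι → F)) : (ι → F) →ₗ[F] (ι → F)) hBb hy hh)
    rw [e1, e2]
  -- the diagonal is continuous, hence integrable on the box
  have hψc : Continuous fun t : F => ((ψ t : Circle) : ℂ) := continuous_addChar_coe hl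
  have hkd : IntegrableOn (fun x => kf x x) (primePowPiBox F ι L) (Measure.pi fun _ : ι => μ) := by
    refine ContinuousOn.integrableOn_compact' (isCompact_primePowPiBox L) (measurableSet_primePowPiBox L)
      (Continuous.continuousOn ?_)
    refine continuous_const.mul (continuous_finsetSum _ fun q _ => continuous_const.mul ?_)
    refine ((hψc.comp (continuous_halfForm _).neg).mul
      ((hψc.comp ?_).mul (hψc.comp (continuous_halfForm _).neg)))
    exact continuous_id.dotProduct ((B_ ((q.out : K) : G)).symm.toLinearMap.continuous_on_pi)
  -- the kernel formula for `ω(z₀) ∘ P` on `U`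
  have hAk : ∀ f ∈ U, ∀ x ∈ primePowPiBox F ι L,
      (((ω z₀ ∘ₗ P) f : SchwartzBruhat (ι → F)) : (ι → F) → ℂ) x =
        ∫ y in primePowPiBox F ι L, kf x y * (f : (ι → F) → ℂ) y ∂(Measure.pi fun _ : ι => μ) := by
    intro f hf x hx
    -- each word term as an integral against the kernel `c · kq`
    have hword : ∀ q : K ⧸ H, ((ω (z₀ * ((q.out : K) : G)) f : SchwartzBruhat (ι → F)) : (ι → F) → ℂ) x =
        ∫ y, c * kq q x y * (f : (ι → F) → ℂ) y ∂(Measure.pi fun _ : ι => μ) := by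
      intro q
      rw [hW1 _ (hqK q) f, Submodule.coe_smul, Pi.smul_apply, smul_eq_mul,
        coe_canonicalWordOp_apply hl μ hψ hm, ← integral_const_mul]
      refine integral_congr_ae (Filter.Eventually.of_forall fun y => ?_)
      simp only [kq]
      have hB0 : (modSqrt (B_ ((q.out : K) : G)) : ℂ) ≠ 0 := Complex.ofReal_ne_zero.2 (modSqrt_pos _).ne'
      field_simp
    -- integrability of the word integrands (they are Schwartz–Bruhat)
    have hint : ∀ q : K ⧸ H, Integrable (fun y => c * kq q x y * (f : (ι → F) → ℂ) y) (Measure.pi fun _ : ι => μ) := by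
      intro q
      have hg : (fun y => ((ψ (dotProductBilin F F y ((B_ ((q.out : K) : G)).symm x)) : Circle) : ℂ) *
          ((unipOpPi hl (δ_ ((q.out : K) : G)) f : SchwartzBruhat (ι → F)) : (ι → F) → ℂ) y) ∈
            SchwartzBruhat (ι → F) :=
        modulation_mul_mem_schwartzBruhat (dotProductBilin F F (m := ι)) ψ hl continuous_dotProductBilin_left _
          (unipOpPi hl (δ_ ((q.out : K) : G)) f).2
      have hI := (integrable_of_mem_schwartzBruhat (Measure.pi fun _ : ι => μ) hg).const_mul
        (c * ((ψ (-halfForm (γ_ ((q.out : K) : G)) x) : Circle) : ℂ))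
      refine hI.congr (Filter.Eventually.of_forall fun y => ?_)
      simp only [kq, coe_unipOpPi_apply, dotProductBilin_apply_apply]
      ring
    rw [LinearMap.comp_apply, hPdef, LinearMap.smul_apply, map_smul, LinearMap.coe_sum, Finset.sum_apply,
      map_sum, Submodule.coe_smul, AddSubmonoidClass.coe_finsetSum, Pi.smul_apply, Finset.sum_apply, smul_eq_mul]
    have hmul : ∀ q : K ⧸ H, ω z₀ (ω ((q.out : K) : G) f) = ω (z₀ * ((q.out : K) : G)) f := fun q => by
      rw [map_mul, Module.End.mul_apply]
    simp only [hmul, hword]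
    rw [← integral_finsetSum _ (fun q _ => hint q), ← integral_const_mul,
      ← setIntegral_eq_integral_of_forall_compl_eq_zero (s := primePowPiBox F ι L)]
    · refine setIntegral_congr_fun (measurableSet_primePowPiBox L) fun y _ => ?_
      simp only [kf, Finset.mul_sum, Finset.sum_mul]
      exact Finset.sum_congr rfl fun q _ => by ring
    · intro y hy
      rw [((hU f).1 hf).1 y hy]
      simp only [mul_zero, Finset.sum_const_zero]
  rw [trace_restrict_boxSpace_eq_setIntegral_diag μ hLL' U hU (ω z₀ ∘ₗ P) (fun u hu => hWU (hTP u hu)) kf hkx hkd hAk]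
  -- (g) the diagonal integral: the common Gauss value
  have hdiag : ∀ q : K ⧸ H, ∫ x in primePowPiBox F ι L, kq q x x ∂(Measure.pi fun _ : ι => μ) = Gv := by
    intro q
    simp only [kq, kernel_diag_eq]
    exact hW2 _ (hqK q) L hLm₀
  have hintq : ∀ q : K ⧸ H, IntegrableOn (fun x => c * kq q x x) (primePowPiBox F ι L) (Measure.pi fun _ : ι => μ) := by
    intro q
    refine ContinuousOn.integrableOn_compact' (isCompact_primePowPiBox L) (measurableSet_primePowPiBox L)
      (Continuous.continuousOn ?_)
    refine continuous_const.mul ?_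
    refine ((hψc.comp (continuous_halfForm _).neg).mul
      ((hψc.comp ?_).mul (hψc.comp (continuous_halfForm _).neg)))
    exact continuous_id.dotProduct ((B_ ((q.out : K) : G)).symm.toLinearMap.continuous_on_pi)
  simp only [kf]
  rw [integral_const_mul, integral_finsetSum _ (fun q _ => hintq q)]
  simp only [integral_const_mul, hdiag, Finset.sum_const, Finset.card_univ, nsmul_eq_mul]
  rw [← mul_assoc, inv_mul_cancel₀ (Nat.cast_ne_zero.2 Fintype.card_ne_zero), one_mul]

end Main

end Literature.RepresentationTheory.HeisenbergGroup

end
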